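import Literature.NumberTheory.LFunctions.GaussianHeckeLSeries
import Literature.NumberTheory.LFunctions.DedekindZetaFiniteOrderProofs
import Literature.Analysis.Complex.RademacherPhragmenLindelof
import HarnessLib

/-!
# A uniform convexity bound for the Hecke `L`-functions `L(s, λ^m)` of `ℚ(i)`

Topic `Literature/NumberTheory/LFunctions`.  For the continued Dirichlet series
`D_m(s) = ∑_{z ≠ 0} λ^m(z) N(z)^{-s} = 4 L(s, λ^m)` (`Literature.NumberTheory.LFunctions.GaussianHecke.heckeL`,
entire for `m ≥ 1`) we PROVE the polynomial bound, UNIFORM in the frequency `m ≥ 1`,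

* `GaussianHecke.norm_heckeL_le_mul_sq` — **`‖D_m(s)‖ ≤ D · ‖s + 2m + 1‖²` for `Re s ≥ -1/2`**, with the
  absolute constant `D = ∑_{z ≠ 0} N(z)^{-3/2}` (written `normSum (3/2)` below; packaged existentially in
  `exists_norm_heckeL_le_mul_sq`),

the input "`log |L(s, λ^m)| ≪ log(|t| + m + 2)` in `σ ≥ 1/4`" of Landau's bound for `L'/L(s, λ^m)`
inside a zero-free region (sequel files; Harman, *Prime-Detecting Sieves*, Lemma 11.6).  Steps:

* `norm_heckeL_le_normSum` — `‖D_m(s)‖ ≤ ∑_{z ≠ 0} N(z)^{-σ}` for `σ > 1` (the Dirichlet series);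
* `heckeL_one_sub` — the **functional equation** `D_m(1 - s) = π^{1-2s} Γ(s+2m)/Γ(1-s+2m) · D_m(s)`
  (Hecke 1920: `Λ_{4m}(4m + 1 - w) = Λ_{4m}(w)` for the Mellin transform of `θ_{4m}`, Mathlib's
  `WeakFEPair.functional_equation` for `GaussianHecke.thetaPair`), whence on `Re s = -1/2`
  `‖D_m(s)‖ = π⁻² ‖(s+2m)(s+2m+1)‖ · ‖D_m(1 - s)‖ ≤ π⁻² D ‖s + 2m + 1‖²` (`norm_heckeL_le_of_re_eq_neg_half`);
* finite order in the strip `-1/2 ≤ Re s ≤ 5/2` from `D_m(s) = π^{s+2m} Γ(s+2m)⁻¹ Λ_{4m}(s+2m)` with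
  `Λ_{4m}` bounded in vertical strips and `‖Γ⁻¹‖ ≤ A e^{c‖·‖²}` there (the tree's
  `NumberField.weakFEPair_exists_norm_Λ₀_le`, `NumberField.exists_norm_inv_Gamma_le_of_abs_re_le`);
* Rademacher's Phragmén–Lindelöf theorem (`Literature.Analysis.Complex.rademacher_phragmenLindelof_of_finiteOrder`)
  between the two edges.

## References

* E. Hecke, *Eine neue Art von Zetafunktionen und ihre Beziehungen zur Verteilung der Primzahlen. II*,
  Math. Z. 6 (1920), 11–51, §9 (functional equation of `ζ(s, λ)` for `ℚ(i)`). [HeckeMathZ1920]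
* H. Rademacher, *On the Phragmén–Lindelöf theorem and some applications*, Math. Z. 72 (1959), Thm 2.
  [Rademacher1959]
* G. Harman, *Prime-Detecting Sieves*, Princeton UP 2007, §11.4 Lemma 11.6 (the consumer). [Harman2007]
-/

noncomputable section

open Complex Real Filter Topology Set MeasureTheory

namespace Literature.NumberTheory.LFunctions

namespace GaussianHecke

/-! ### The Dirichlet series bound `‖D_m(s)‖ ≤ ∑_{z ≠ 0} N(z)^{-σ}` -/

/-! Below, `normSum σ` in the docstrings stands for the real number `∑' z : GaussianInt, N(z)^{-σ}`
(`= D_0(σ) = 4 ζ_{ℚ(i)}(σ)` for `σ > 1`; the term `z = 0` contributes `0^{-σ} = 0`), always written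
out in the statements (its terms are summable for `σ > 1`: `GaussianTheta.summable_norm_rpow_neg`); the
absolute constant of this file is `normSum (3/2) = ∑_{z ≠ 0} N(z)^{-3/2}`. -/

/-- The terms of `normSum` are nonnegative. [folklore] -/
theorem normSum_term_nonneg (σ : ℝ) (x : GaussianInt) : 0 ≤ ((x.norm : ℤ) : ℝ) ^ (-σ) :=
  Real.rpow_nonneg (by exact_mod_cast GaussianInt.norm_nonneg x) _

/-- `1 ≤ normSum σ` for `σ > 1` (the term `z = 1`). [folklore] -/
theorem one_le_normSum {σ : ℝ} (hσ : 1 < σ) : 1 ≤ ∑' x : GaussianInt, ((x.norm : ℤ) : ℝ) ^ (-σ) := by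
  have h := (GaussianTheta.summable_norm_rpow_neg hσ).sum_le_tsum {1}
    (fun x _ ↦ normSum_term_nonneg σ x)
  simpa using h

/-- `normSum σ > 0` for `σ > 1`. [folklore] -/
theorem normSum_pos {σ : ℝ} (hσ : 1 < σ) : 0 < ∑' x : GaussianInt, ((x.norm : ℤ) : ℝ) ^ (-σ) :=
  lt_of_lt_of_le one_pos (one_le_normSum hσ)

/-- Monotonicity: `normSum σ' ≤ normSum σ` for `1 < σ ≤ σ'` (`N(z) ≥ 1` for `z ≠ 0`). [folklore] -/
theorem normSum_anti {σ σ' : ℝ} (hσ : 1 < σ) (h : σ ≤ σ') :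
    (∑' x : GaussianInt, ((x.norm : ℤ) : ℝ) ^ (-σ')) ≤ ∑' x : GaussianInt, ((x.norm : ℤ) : ℝ) ^ (-σ) := by
  refine (GaussianTheta.summable_norm_rpow_neg (lt_of_lt_of_le hσ h)).tsum_le_tsum (fun x ↦ ?_)
    (GaussianTheta.summable_norm_rpow_neg hσ)
  rcases eq_or_ne x 0 with rfl | hx
  · simp [Real.zero_rpow (by linarith : -σ' ≠ 0), Real.zero_rpow (by linarith : -σ ≠ 0)]
  · have h1 : (1 : ℝ) ≤ ((x.norm : ℤ) : ℝ) := by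
      have := GaussianInt.norm_pos.mpr hx
      exact_mod_cast this
    exact Real.rpow_le_rpow_of_exponent_le h1 (by linarith)

/-- The norm of a summand of `D_m(s)`: `‖[x ≠ 0] λ^m(x) N(x)^{-s}‖ = N(x)^{-Re s}` for `x ≠ 0`, and `0`
for `x = 0`; in all cases `≤ N(x)^{-Re s}` when `Re s ≠ 0`. [folklore] -/
theorem norm_heckeL_term_le (m : ℕ) {s : ℂ} (hs : s.re ≠ 0) (x : GaussianInt) :
    ‖(if x = 0 then 0 else GaussianInt.angularChar m x / (((x.norm : ℝ)) : ℂ) ^ s)‖ ≤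
      ((x.norm : ℤ) : ℝ) ^ (-s.re) := by
  rcases eq_or_ne x 0 with rfl | hx
  · simp [Real.zero_rpow (neg_ne_zero.mpr hs)]
  · rw [if_neg hx, norm_div, GaussianInt.norm_angularChar hx]
    have hN : (0 : ℝ) < ((x.norm : ℤ) : ℝ) := by exact_mod_cast GaussianInt.norm_pos.mpr hx
    have : (((x.norm : ℝ)) : ℂ) = ((((x.norm : ℤ) : ℝ) : ℝ) : ℂ) := by norm_cast
    rw [this, Complex.norm_cpow_eq_rpow_re_of_pos hN, one_div, Real.rpow_neg hN.le]

/-- **`‖D_m(s)‖ ≤ ∑_{z ≠ 0} N(z)^{-σ}` for `σ = Re s > 1`** (any `m`). [folklore] -/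
theorem norm_heckeL_le_normSum (m : ℕ) {s : ℂ} (hs : 1 < s.re) :
    ‖heckeL m s‖ ≤ ∑' x : GaussianInt, ((x.norm : ℤ) : ℝ) ^ (-s.re) := by
  rw [← (hasSum_heckeL m hs).tsum_eq]
  exact tsum_of_norm_bounded (GaussianTheta.summable_norm_rpow_neg hs).hasSum
    (fun x ↦ norm_heckeL_term_le m (by linarith) x)

/-- `‖D_m(s)‖ ≤ normSum (3/2)` for `Re s ≥ 3/2` (any `m`). [folklore] -/
theorem norm_heckeL_le_of_le_re (m : ℕ) {s : ℂ} (hs : 3 / 2 ≤ s.re) :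
    ‖heckeL m s‖ ≤ (∑' x : GaussianInt, ((x.norm : ℤ) : ℝ) ^ (-(3 / 2 : ℝ))) :=
  (norm_heckeL_le_normSum m (by linarith)).trans (normSum_anti (by norm_num) hs)


/-! ### The functional equation `D_m(1 - s) ↔ D_m(s)` -/

/-- The root number of the FE-pair of `θ_{4m}` is `i^{4m} = 1`. [folklore] -/
theorem thetaPair_ε_four_mul (m : ℕ) : (thetaPair (4 * m)).ε = 1 := by
  show I ^ (4 * m) = 1
  rw [pow_mul, Complex.I_pow_four, one_pow]

/-- The weight of the FE-pair of `θ_k` is `k + 1`. [folklore] -/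
theorem thetaPair_k_cast (k : ℕ) : (((thetaPair k).k : ℝ) : ℂ) = (k : ℂ) + 1 := by
  show (((k : ℝ) + 1 : ℝ) : ℂ) = (k : ℂ) + 1
  push_cast
  ring

/-- For `k ≥ 1` the FE-pair of `θ_k` is self-dual: `Λ` of the symmetric pair is the same function
(`f = g = θ_k`). [folklore] -/
theorem thetaPair_symm_Λ {k : ℕ} (hk : k ≠ 0) : (thetaPair k).symm.Λ = (thetaPair k).Λ := by
  have hP := isStrongFEPair_thetaPair hk
  rw [hP.symm_Λ_eq, hP.Λ_eq]
  rfl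

/-- **Hecke's functional equation for `Λ_{4m}`** (`m ≥ 1`): `Λ_{4m}(4m + 1 - w) = Λ_{4m}(w)`
(`θ_{4m}(1/t) = t^{4m+1} θ_{4m}(t)`, root number `i^{4m} = 1`). [cite: HeckeMathZ1920, §9] -/
theorem thetaPair_Λ_sub {m : ℕ} (hm : m ≠ 0) (w : ℂ) :
    (thetaPair (4 * m)).Λ (4 * m + 1 - w) = (thetaPair (4 * m)).Λ w := by
  have h4 : 4 * m ≠ 0 := by omega
  have h := (thetaPair (4 * m)).functional_equation w
  rw [thetaPair_symm_Λ h4, thetaPair_ε_four_mul, one_smul, thetaPair_k_cast] at h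
  rw [← h]
  congr 1
  push_cast
  ring

/-- **The functional equation of `D_m`** (`m ≥ 1`): whenever `Γ(s + 2m) ≠ 0`,
`D_m(1 - s) = π^{(1-s)+2m} π^{-(s+2m)} · Γ(s+2m)/Γ((1-s)+2m) · D_m(s)`, i.e.
`π^{-(1-s)} Γ(1-s+2m) L(1-s, λ^m) = π^{-s} Γ(s+2m) L(s, λ^m)` (Hecke 1920, §9, for `ℚ(i)` and the
character `λ^m` of conductor `1`). [cite: HeckeMathZ1920, §9] -/
theorem heckeL_one_sub {m : ℕ} (hm : m ≠ 0) {s : ℂ} (hs : Complex.Gamma (s + 2 * m) ≠ 0) :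
    heckeL m (1 - s) = (π : ℂ) ^ ((1 - s) + 2 * m) * ((π : ℂ) ^ (s + 2 * m))⁻¹ *
      (Complex.Gamma (s + 2 * m) / Complex.Gamma ((1 - s) + 2 * m)) * heckeL m s := by
  have hπ : (π : ℂ) ≠ 0 := ofReal_ne_zero.mpr Real.pi_ne_zero
  have hπs : (π : ℂ) ^ (s + 2 * m) ≠ 0 := by
    rw [Ne, cpow_eq_zero_iff]; exact fun h ↦ hπ h.1
  have hΛ : (thetaPair (4 * m)).Λ ((1 - s) + 2 * m) = (thetaPair (4 * m)).Λ (s + 2 * m) := by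
    rw [← thetaPair_Λ_sub hm (s + 2 * m)]
    congr 1
    ring
  unfold heckeL
  rw [hΛ]
  field_simp

/-- `Γ(w + 2) = (w + 1) w Γ(w)` for `Re w > 0`. [folklore] -/
theorem Gamma_add_two {w : ℂ} (hw : 0 < w.re) :
    Complex.Gamma (w + 2) = (w + 1) * w * Complex.Gamma w := by
  have hw0 : w ≠ 0 := fun h ↦ by rw [h, zero_re] at hw; exact lt_irrefl _ hw
  have hw1 : w + 1 ≠ 0 := fun h ↦ by
    have := congrArg Complex.re h; simp at this; linarith
  rw [show w + 2 = (w + 1) + 1 by ring, Complex.Gamma_add_one _ hw1, Complex.Gamma_add_one _ hw0]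
  ring

/-- **The left edge.** For `m ≥ 1` and `Re s = -1/2`:
`‖D_m(s)‖ ≤ π⁻² · normSum (3/2) · ‖s + 2m + 1‖²` (functional equation, `Γ(w̄ + 2) = (w̄+1) w̄ Γ(w̄)` with
`w = s + 2m`, `|Γ(w̄)| = |Γ(w)|`, `|w| ≤ |w + 1|`, and the Dirichlet-series bound at `Re = 3/2`).
[cite: HeckeMathZ1920, §9] -/
theorem norm_heckeL_le_of_re_eq_neg_half {m : ℕ} (hm : m ≠ 0) {s : ℂ} (hs : s.re = -1 / 2) :
    ‖heckeL m s‖ ≤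
      π⁻¹ ^ 2 * (∑' x : GaussianInt, ((x.norm : ℤ) : ℝ) ^ (-(3 / 2 : ℝ))) * ‖s + 2 * m + 1‖ ^ 2 := by
  have hm1 : (1 : ℝ) ≤ m := by exact_mod_cast Nat.one_le_iff_ne_zero.mpr hm
  -- `s = 1 - s'` with `Re s' = 3/2`
  set s' : ℂ := 1 - s with hs'def
  have hss' : s = 1 - s' := by rw [hs'def]; ring
  have hs're : s'.re = 3 / 2 := by rw [hs'def, sub_re, one_re, hs]; norm_num
  set w : ℂ := s + 2 * m with hwdef
  have hwre : w.re = 2 * m - 1 / 2 := by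
    rw [hwdef, add_re, hs]; simp; ring
  have hwre0 : 0 < w.re := by rw [hwre]; linarith
  -- `s' + 2m = conj (w + 2)`
  have hconj : s' + 2 * m = starRingEnd ℂ (w + 2) := by
    apply Complex.ext
    · simp [hs'def, hwdef, hs]; ring
    · simp [hs'def, hwdef]
  have hΓw : Complex.Gamma w ≠ 0 := Complex.Gamma_ne_zero_of_re_pos hwre0
  have hΓs' : Complex.Gamma (s' + 2 * m) ≠ 0 := by
    rw [hconj, Complex.Gamma_conj]
    exact (map_ne_zero _).mpr (Complex.Gamma_ne_zero_of_re_pos (by simp; linarith))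
  have hFE := heckeL_one_sub hm hΓs'
  rw [← hss', ← hwdef] at hFE
  -- norms of the factors
  have hπpos : (0 : ℝ) < π := Real.pi_pos
  have hn1 : ‖(π : ℂ) ^ w‖ = π ^ (2 * (m : ℝ) - 1 / 2) := by
    rw [Complex.norm_cpow_eq_rpow_re_of_pos hπpos, hwre]
  have hn2 : ‖((π : ℂ) ^ (s' + 2 * m))⁻¹‖ = π ^ (-(2 * (m : ℝ) + 3 / 2)) := by
    rw [norm_inv, Complex.norm_cpow_eq_rpow_re_of_pos hπpos, ← Real.rpow_neg hπpos.le]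
    congr 1
    rw [add_re, hs're]; simp; ring
  have hn3 : ‖Complex.Gamma (s' + 2 * m) / Complex.Gamma w‖ = ‖w + 1‖ * ‖w‖ := by
    rw [hconj, Complex.Gamma_conj, norm_div, Complex.norm_conj, Gamma_add_two hwre0, norm_mul, norm_mul,
      mul_div_assoc, div_self (norm_ne_zero_iff.mpr hΓw), mul_one]
  have hn4 : ‖heckeL m s'‖ ≤ (∑' x : GaussianInt, ((x.norm : ℤ) : ℝ) ^ (-(3 / 2 : ℝ))) :=
    norm_heckeL_le_of_le_re m (by rw [hs're])
  have hww : ‖w‖ ≤ ‖w + 1‖ := by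
    have h1 : ‖w‖ ^ 2 ≤ ‖w + 1‖ ^ 2 := by
      rw [Complex.sq_norm, Complex.sq_norm, Complex.normSq_apply, Complex.normSq_apply]
      simp; nlinarith
    exact (sq_le_sq₀ (norm_nonneg _) (norm_nonneg _)).mp h1
  have hππ : π ^ (2 * (m : ℝ) - 1 / 2) * π ^ (-(2 * (m : ℝ) + 3 / 2)) = π⁻¹ ^ 2 := by
    rw [← Real.rpow_add hπpos, show 2 * (m : ℝ) - 1 / 2 + -(2 * (m : ℝ) + 3 / 2) = -2 by ring,
      Real.rpow_neg hπpos.le, Real.rpow_two, inv_pow]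
  calc ‖heckeL m s‖ = ‖(π : ℂ) ^ w‖ * ‖((π : ℂ) ^ (s' + 2 * m))⁻¹‖ *
        ‖Complex.Gamma (s' + 2 * m) / Complex.Gamma w‖ * ‖heckeL m s'‖ := by
        rw [hFE, norm_mul, norm_mul, norm_mul]
    _ = π⁻¹ ^ 2 * (‖w + 1‖ * ‖w‖) * ‖heckeL m s'‖ := by rw [hn1, hn2, hn3, hππ]
    _ ≤ π⁻¹ ^ 2 * (‖w + 1‖ * ‖w + 1‖) * (∑' x : GaussianInt, ((x.norm : ℤ) : ℝ) ^ (-(3 / 2 : ℝ))) := by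
        gcongr
    _ = π⁻¹ ^ 2 * (∑' x : GaussianInt, ((x.norm : ℤ) : ℝ) ^ (-(3 / 2 : ℝ))) * ‖s + 2 * m + 1‖ ^ 2 := by
        rw [hwdef]; ring


/-! ### Finite order in the strip `-1/2 ≤ Re s ≤ 5/2` -/

/-- For `m ≥ 1`, `Λ_{4m} = Λ₀` (the FE-pair of `θ_{4m}` has no constant terms). [folklore] -/
theorem thetaPair_Λ_eq_Λ₀ {m : ℕ} (hm : m ≠ 0) (w : ℂ) :
    (thetaPair (4 * m)).Λ w = (thetaPair (4 * m)).Λ₀ w := by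
  have h4 : 4 * m ≠ 0 := by omega
  have hf : (thetaPair (4 * m)).f₀ = 0 := if_neg h4
  have hg : (thetaPair (4 * m)).g₀ = 0 := if_neg h4
  rw [WeakFEPair.Λ, hf, hg, smul_zero, smul_zero, sub_zero, sub_zero]

/-- **`D_m` has finite order in the strip** (`m ≥ 1`): there is `C = C(m)` with
`‖D_m(z)‖ ≤ C exp(|Im z|³)` for `-1/2 ≤ Re z ≤ 5/2` — from `D_m(z) = π^{z+2m} Γ(z+2m)⁻¹ Λ_{4m}(z+2m)`,
`Λ_{4m}` bounded in vertical strips and `‖Γ(u)⁻¹‖ ≤ A e^{c‖u‖²}` for `|Re u| ≤ 2m + 5/2`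
(`c t² ≤ |t|³ + c³`).  Only the existence of such a bound matters (Phragmén–Lindelöf). [folklore] -/
theorem exists_norm_heckeL_le_exp {m : ℕ} (hm : m ≠ 0) :
    ∃ C : ℝ, ∀ z : ℂ, -1 / 2 ≤ z.re → z.re ≤ 5 / 2 →
      ‖heckeL m z‖ ≤ C * Real.exp (|z.im| ^ (3 : ℝ)) := by
  set S : ℝ := 2 * m + 5 / 2 with hSdef
  have hS0 : 0 ≤ S := by positivity
  obtain ⟨A, c, hA, hc, hΓ⟩ := NumberField.exists_norm_inv_Gamma_le_of_abs_re_le hS0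
  obtain ⟨M, hM0, hM⟩ :=
    NumberField.weakFEPair_exists_norm_Λ₀_le (thetaPair (4 * m)) (2 * m - 1 / 2) (2 * m + 5 / 2)
  refine ⟨π ^ S * A * Real.exp (c * S ^ 2) * Real.exp (c ^ 3) * M, fun z hz1 hz2 ↦ ?_⟩
  have hπ1 : (1 : ℝ) ≤ π := by linarith [Real.pi_gt_three]
  unfold heckeL
  set u : ℂ := z + 2 * m with hudef
  have hure : u.re = z.re + 2 * m := by simp [hudef]
  have huim : u.im = z.im := by simp [hudef]
  have h1 : ‖(π : ℂ) ^ u‖ ≤ π ^ S := by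
    rw [Complex.norm_cpow_eq_rpow_re_of_pos Real.pi_pos]
    exact Real.rpow_le_rpow_of_exponent_le hπ1 (by rw [hure, hSdef]; linarith)
  have h2 : ‖(Complex.Gamma u)⁻¹‖ ≤ A * Real.exp (c * ‖u‖ ^ 2) :=
    hΓ u (by rw [hure, hSdef, abs_le]; constructor <;> linarith)
  have h3 : ‖(thetaPair (4 * m)).Λ u‖ ≤ M := by
    rw [thetaPair_Λ_eq_Λ₀ hm]
    exact hM u (by rw [hure]; linarith) (by rw [hure]; linarith)
  have h4 : ‖u‖ ^ 2 ≤ S ^ 2 + z.im ^ 2 := by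
    rw [Complex.sq_norm, Complex.normSq_apply, huim]
    have hre : |u.re| ≤ S := by rw [hure, hSdef, abs_le]; constructor <;> linarith
    have := (sq_le_sq' (abs_le.mp hre).1 (abs_le.mp hre).2)
    nlinarith
  have h5 : c * z.im ^ 2 ≤ |z.im| ^ (3 : ℝ) + c ^ 3 := by
    have h := NumberField.mul_sq_le_cube_add hc (abs_nonneg z.im)
    rw [sq_abs] at h
    rw [show (3 : ℝ) = ((3 : ℕ) : ℝ) by norm_num, Real.rpow_natCast]
    exact h
  calc ‖(π : ℂ) ^ u * (Complex.Gamma u)⁻¹ * (thetaPair (4 * m)).Λ u‖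
      = ‖(π : ℂ) ^ u‖ * ‖(Complex.Gamma u)⁻¹‖ * ‖(thetaPair (4 * m)).Λ u‖ := by
        rw [norm_mul, norm_mul]
    _ ≤ π ^ S * (A * Real.exp (c * ‖u‖ ^ 2)) * M := by gcongr
    _ ≤ π ^ S * (A * Real.exp (c * (S ^ 2 + z.im ^ 2))) * M := by gcongr
    _ = π ^ S * A * Real.exp (c * S ^ 2) * Real.exp (c * z.im ^ 2) * M := by
        rw [mul_add, Real.exp_add]; ring
    _ ≤ π ^ S * A * Real.exp (c * S ^ 2) * Real.exp (|z.im| ^ (3 : ℝ) + c ^ 3) * M := by gcongr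
    _ = π ^ S * A * Real.exp (c * S ^ 2) * Real.exp (c ^ 3) * M * Real.exp (|z.im| ^ (3 : ℝ)) := by
        rw [Real.exp_add]; ring

/-! ### The convexity bound -/

/-- **Uniform convexity bound for `D_m = 4 L(·, λ^m)` in the strip** (`m ≥ 1`): for
`-1/2 ≤ Re z ≤ 5/2`, `‖D_m(z)‖ ≤ D ‖z + 2m + 1‖²` with the absolute
`D = normSum (3/2) = ∑_{z≠0} N(z)^{-3/2}`.
Rademacher's Phragmén–Lindelöf theorem on `[-1/2, 5/2]` with `Q = 2m + 1`, exponents `α = 2` (left edge,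
`norm_heckeL_le_of_re_eq_neg_half`) and `β = 0` (right edge, the Dirichlet series), growth
`exists_norm_heckeL_le_exp`; the interpolated bound `(π⁻²D X²)^p (D)^q`, `p + q = 1`, `X = ‖z+2m+1‖ ≥ 1`, is
at most `D X²`. [cite: Rademacher1959, Thm 2] -/
theorem norm_heckeL_le_mul_sq_of_mem_strip {m : ℕ} (hm : m ≠ 0) {z : ℂ} (hz1 : -1 / 2 ≤ z.re)
    (hz2 : z.re ≤ 5 / 2) :
    ‖heckeL m z‖ ≤ (∑' x : GaussianInt, ((x.norm : ℤ) : ℝ) ^ (-(3 / 2 : ℝ))) * ‖z + 2 * m + 1‖ ^ 2 := by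
  set D : ℝ := (∑' x : GaussianInt, ((x.norm : ℤ) : ℝ) ^ (-(3 / 2 : ℝ))) with hDdef
  have hD : 0 < D := normSum_pos (by norm_num)
  set A : ℝ := π⁻¹ ^ 2 * D with hAdef
  have hA : 0 < A := by positivity
  have hAD : A ≤ D := by
    have hπ1 : (1 : ℝ) ≤ π := by linarith [Real.pi_gt_three]
    have h1 : π⁻¹ ^ 2 ≤ 1 := pow_le_one₀ (by positivity) (inv_le_one_of_one_le₀ hπ1)
    calc A = π⁻¹ ^ 2 * D := rfl
      _ ≤ 1 * D := by gcongr
      _ = D := one_mul D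
  obtain ⟨C, hC⟩ := exists_norm_heckeL_le_exp hm
  set Q : ℝ := 2 * m + 1 with hQdef
  have hQz : ∀ w : ℂ, (Q : ℂ) + w = w + 2 * m + 1 := fun w ↦ by
    rw [hQdef]; push_cast; ring
  have key := Literature.Analysis.Complex.rademacher_phragmenLindelof_of_finiteOrder
    (f := heckeL m) (a := -1 / 2) (b := 5 / 2) (Q := Q) (A := A) (B := D) (α := 2) (β := 0) (C := C)
    (c := 3) (by norm_num) (by rw [hQdef]; linarith [(Nat.cast_nonneg m : (0 : ℝ) ≤ m)]) hA hD (by norm_num)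
    (differentiable_heckeL hm).diffContOnCl (by norm_num)
    (fun w hw1 hw2 ↦ hC w hw1.le hw2.le)
    (fun w hw ↦ by
      rw [hQz w, Real.rpow_two]
      exact norm_heckeL_le_of_re_eq_neg_half hm hw)
    (fun w hw ↦ by
      rw [Real.rpow_zero, mul_one]
      exact norm_heckeL_le_of_le_re m (by rw [hw]; norm_num))
    hz1 hz2
  rw [Real.rpow_zero, mul_one, hQz z, Real.rpow_two] at key
  set X : ℝ := ‖z + 2 * m + 1‖ with hXdef
  have hm1 : (1 : ℝ) ≤ m := by exact_mod_cast Nat.one_le_iff_ne_zero.mpr hm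
  have hX1 : 1 ≤ X := by
    calc (1 : ℝ) ≤ (z + 2 * m + 1).re := by simp; linarith
      _ ≤ X := Complex.re_le_norm _
  have hp : 0 ≤ (5 / 2 - z.re) / (5 / 2 - -1 / 2) := by
    apply div_nonneg <;> linarith
  have hq : 0 ≤ (z.re - -1 / 2) / (5 / 2 - -1 / 2) := by
    apply div_nonneg <;> linarith
  have hpq : (5 / 2 - z.re) / (5 / 2 - -1 / 2) + (z.re - -1 / 2) / (5 / 2 - -1 / 2) = 1 := by
    field_simp; ring
  have hDX : 0 < D * X ^ 2 := by positivity
  have h1 : A * X ^ 2 ≤ D * X ^ 2 := by gcongr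
  have h2 : D ≤ D * X ^ 2 := le_mul_of_one_le_right hD.le (one_le_pow₀ hX1)
  calc ‖heckeL m z‖
      ≤ (A * X ^ 2) ^ ((5 / 2 - z.re) / (5 / 2 - -1 / 2)) * D ^ ((z.re - -1 / 2) / (5 / 2 - -1 / 2)) := key
    _ ≤ (D * X ^ 2) ^ ((5 / 2 - z.re) / (5 / 2 - -1 / 2)) *
          (D * X ^ 2) ^ ((z.re - -1 / 2) / (5 / 2 - -1 / 2)) := by
        apply mul_le_mul
        · exact Real.rpow_le_rpow (by positivity) h1 hp
        · exact Real.rpow_le_rpow hD.le h2 hq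
        · positivity
        · positivity
    _ = D * X ^ 2 := by rw [← Real.rpow_add hDX, hpq, Real.rpow_one]

/-- **`‖D_m(z)‖ ≤ D ‖z + 2m + 1‖²` on the whole half-plane `Re z ≥ -1/2`** (`m ≥ 1`,
`D = normSum (3/2)`): the strip bound, and the Dirichlet series for `Re z ≥ 3/2` (where
`‖z + 2m + 1‖ ≥ 1`). [cite: Rademacher1959, Thm 2] -/
theorem norm_heckeL_le_mul_sq {m : ℕ} (hm : m ≠ 0) {z : ℂ} (hz : -1 / 2 ≤ z.re) :
    ‖heckeL m z‖ ≤ (∑' x : GaussianInt, ((x.norm : ℤ) : ℝ) ^ (-(3 / 2 : ℝ))) * ‖z + 2 * m + 1‖ ^ 2 := by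
  rcases le_or_gt z.re (5 / 2) with h | h
  · exact norm_heckeL_le_mul_sq_of_mem_strip hm hz h
  · have hm1 : (1 : ℝ) ≤ m := by exact_mod_cast Nat.one_le_iff_ne_zero.mpr hm
    have hX1 : 1 ≤ ‖z + 2 * m + 1‖ := by
      calc (1 : ℝ) ≤ (z + 2 * m + 1).re := by simp; linarith
        _ ≤ ‖z + 2 * m + 1‖ := Complex.re_le_norm _
    calc ‖heckeL m z‖ ≤ (∑' x : GaussianInt, ((x.norm : ℤ) : ℝ) ^ (-(3 / 2 : ℝ))) :=
          norm_heckeL_le_of_le_re m (by linarith)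
      _ ≤ (∑' x : GaussianInt, ((x.norm : ℤ) : ℝ) ^ (-(3 / 2 : ℝ))) * ‖z + 2 * m + 1‖ ^ 2 :=
          le_mul_of_one_le_right (normSum_pos (by norm_num)).le (one_le_pow₀ hX1)

/-- The same bound through `‖z + 2m + 1‖ ≤ |Im z| + 2m + 4`: for `-1/2 ≤ Re z ≤ 3`,
`‖D_m(z)‖ ≤ D (|Im z| + 2m + 4)²` (`D = normSum (3/2)`). [folklore] -/
theorem norm_heckeL_le_mul_sq' {m : ℕ} (hm : m ≠ 0) {z : ℂ} (hz : -1 / 2 ≤ z.re) (hz3 : z.re ≤ 3) :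
    ‖heckeL m z‖ ≤
      (∑' x : GaussianInt, ((x.norm : ℤ) : ℝ) ^ (-(3 / 2 : ℝ))) * (|z.im| + 2 * m + 4) ^ 2 := by
  refine (norm_heckeL_le_mul_sq hm hz).trans ?_
  have h : ‖z + 2 * m + 1‖ ≤ |z.im| + 2 * m + 4 := by
    refine (Complex.norm_le_abs_re_add_abs_im _).trans ?_
    have hre : |(z + 2 * m + 1).re| ≤ 2 * m + 4 := by
      simp only [add_re, mul_re, re_ofNat, natCast_re, im_ofNat, natCast_im, mul_zero, sub_zero, one_re]
      rw [abs_le]; constructor <;> nlinarith [(Nat.cast_nonneg m : (0 : ℝ) ≤ m)]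
    have him : |(z + 2 * m + 1).im| = |z.im| := by simp
    rw [him]; linarith
  exact mul_le_mul_of_nonneg_left (pow_le_pow_left₀ (norm_nonneg _) h 2)
    (normSum_pos (show (1 : ℝ) < 3 / 2 by norm_num)).le


/-- **Existential packaging** of the convexity bound: an absolute `D > 0` with
`‖D_m(z)‖ ≤ D ‖z + 2m + 1‖²` for all `m ≥ 1`, `Re z ≥ -1/2`, and `‖D_m(z)‖ ≤ D` for `Re z ≥ 3/2` (all `m`).
[cite: Rademacher1959, Thm 2] -/
theorem exists_norm_heckeL_le_mul_sq :
    ∃ D : ℝ, 0 < D ∧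
      (∀ m : ℕ, m ≠ 0 → ∀ z : ℂ, -1 / 2 ≤ z.re → ‖heckeL m z‖ ≤ D * ‖z + 2 * m + 1‖ ^ 2) ∧
      (∀ (m : ℕ) (z : ℂ), 3 / 2 ≤ z.re → ‖heckeL m z‖ ≤ D) :=
  ⟨(∑' x : GaussianInt, ((x.norm : ℤ) : ℝ) ^ (-(3 / 2 : ℝ))), normSum_pos (by norm_num),
    fun _ hm _ hz ↦ norm_heckeL_le_mul_sq hm hz,
    fun m _ hz ↦ norm_heckeL_le_of_le_re m hz⟩

end GaussianHecke

end Literature.NumberTheory.LFunctions
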